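import Mathlib
import Literature.Computability.AlgebraicComplexity.RealTauKnownCases
import Summits.ValiantsHypothesis.ValiantsHypothesis.Theses.LacunarySymmetroid

/-!
# Skeleton-vet finding (refuter, stmt-ValiantsHypothesis-18050): the birth design's only open stub
is EQUIVALENT to the crux

Birth design of `LacunarySymmetroid.MatrixDescartes` as described in the route header (TWO-LAYER
PLAN; the planner's `bc/MatrixDescartes_birth.lean` is evidence-only and unregistered):

  stub_descartesPencil  : Z ≤ 2(m+K)^m + 1                       (Descartes on the exponents)
  stub_coreLargeFormats : the crux on the formats K < m(⌊log₂(m+K)⌋+1)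
  MatrixDescartes_of    : stub_descartesPencil → stub_coreLargeFormats → MatrixDescartes.

This file, sorry-free:
* §2 PROVES `stub_descartesPencil` (support of det Σ_l X^{d_l} S_l has ≤ K^m exponents — one per
  row-to-term map — and the tree's sparse Descartes `card_roots_toFinset_le_of_card_support`);
* §3 re-proves the assembly against the tree decl;
* §4 concludes `MatrixDescartes ↔ Sig.stub_coreLargeFormats`.

So after registration the skeleton would have exactly ONE open stub, kernel-equivalent to the crux:
a sector peel (the Descartes-trivial formats), not a decomposition — BC3's "no stub cheaply ⟺ its
crux" fails in substance (the cheap-tactic probes fail only because `first | exact? | simpa | aesop`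
cannot do the Descartes arithmetic).
-/

set_option linter.dupNamespace false

namespace Summit.ValiantsHypothesis.ValiantsHypothesis.Cruxes.MatrixDescartes.Design

open Summit.ValiantsHypothesis.ValiantsHypothesis.Theses.LacunarySymmetroid
open Polynomial Finset
open scoped BigOperators Polynomial

/-! ## §1 The two stub statements (as in the route header) -/

/-- DescartesPencil. -/
def Sig.stub_descartesPencil : Prop :=
  ∀ (K m : ℕ) (d : Fin K → ℕ) (S : Fin K → Matrix (Fin m) (Fin m) ℝ), (∀ l, (S l).IsSymm) →
    (Matrix.det (∑ l, ((Polynomial.X : Polynomial ℝ) ^ d l) • (S l).map Polynomial.C)).roots.toFinset.card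
      ≤ 2 * (m + K) ^ m + 1

/-- CoreLargeFormats: the crux restricted to `K < m (⌊log₂(m+K)⌋ + 1)`. -/
def Sig.stub_coreLargeFormats : Prop :=
  ∀ c q : ℕ, 0 < q → ∃ K₀ : ℕ, ∀ K m : ℕ, K₀ ≤ K → m ≤ 2 ^ ((Nat.log 2 K + c) ^ c) →
    K < m * (Nat.log 2 (m + K) + 1) →
    ∀ (d : Fin K → ℕ) (S : Fin K → Matrix (Fin m) (Fin m) ℝ), (∀ l, (S l).IsSymm) →
      (Matrix.det (∑ l, ((Polynomial.X : Polynomial ℝ) ^ d l) • (S l).map Polynomial.C)).roots.toFinset.card ^ q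
        ≤ 2 ^ (K * Nat.log 2 K)

/-! ## §2 DescartesPencil is a theorem -/

section pencil

variable {K m : ℕ}

/-- The lacunary pencil `Σ_l X^{d_l} • S_l` as a polynomial matrix. -/
noncomputable def pencil (d : Fin K → ℕ) (S : Fin K → Matrix (Fin m) (Fin m) ℝ) :
    Matrix (Fin m) (Fin m) ℝ[X] :=
  ∑ l, (X : ℝ[X]) ^ d l • (S l).map C

theorem pencil_apply (d : Fin K → ℕ) (S : Fin K → Matrix (Fin m) (Fin m) ℝ) (i j : Fin m) :
    pencil d S i j = ∑ l, X ^ d l * C (S l i j) := by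
  simp [pencil, Matrix.sum_apply, Matrix.smul_apply, smul_eq_mul]

/-- Leibniz expansion of the pencil determinant as a sum of monomials indexed by a permutation and
a row-to-term map `f : Fin m → Fin K`; the exponent `Σ_i d (f i)` depends on `f` only. -/
theorem det_pencil_eq (d : Fin K → ℕ) (S : Fin K → Matrix (Fin m) (Fin m) ℝ) :
    (pencil d S).det =
      ∑ σ : Equiv.Perm (Fin m), ∑ f : Fin m → Fin K,
        ((Equiv.Perm.sign σ : ℤ) : ℝ[X]) * (C (∏ i, S (f i) (σ i) i) * X ^ (∑ i, d (f i))) := by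
  rw [Matrix.det_apply']
  refine Finset.sum_congr rfl fun σ _ => ?_
  rw [← Finset.mul_sum]
  congr 1
  simp_rw [pencil_apply]
  rw [Fintype.prod_sum]
  refine Finset.sum_congr rfl fun f _ => ?_
  rw [Finset.prod_mul_distrib, Finset.prod_pow_eq_pow_sum, ← map_prod C, mul_comm]

/-- Coefficients of the pencil determinant vanish off the exponent set `{Σ_i d (f i)}`. -/
theorem coeff_det_pencil_eq_zero (d : Fin K → ℕ) (S : Fin K → Matrix (Fin m) (Fin m) ℝ) {n : ℕ}
    (hn : ∀ f : Fin m → Fin K, (∑ i, d (f i)) ≠ n) : (pencil d S).det.coeff n = 0 := by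
  rw [det_pencil_eq, finsetSum_coeff]
  refine Finset.sum_eq_zero fun σ _ => ?_
  rw [finsetSum_coeff]
  refine Finset.sum_eq_zero fun f _ => ?_
  rw [← C_eq_intCast, ← mul_assoc, ← C_mul, coeff_C_mul_X_pow, if_neg (fun h => hn f h.symm)]

/-- The support of the pencil determinant has at most `K ^ m` exponents. -/
theorem card_support_det_pencil_le (d : Fin K → ℕ) (S : Fin K → Matrix (Fin m) (Fin m) ℝ) :
    (pencil d S).det.support.card ≤ K ^ m := by
  classical
  have hsub : (pencil d S).det.support ⊆
      Finset.univ.image (fun f : Fin m → Fin K => ∑ i, d (f i)) := by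
    intro n hn
    rw [mem_support_iff] at hn
    by_contra h
    exact hn (coeff_det_pencil_eq_zero d S fun f hf => h (Finset.mem_image.mpr ⟨f, Finset.mem_univ _, hf⟩))
  calc (pencil d S).det.support.card
      ≤ (Finset.univ.image (fun f : Fin m → Fin K => ∑ i, d (f i))).card := Finset.card_le_card hsub
    _ ≤ (Finset.univ : Finset (Fin m → Fin K)).card := Finset.card_image_le
    _ = K ^ m := by simp

end pencil

/-- **DescartesPencil holds** (so it is not an open stub): `Z ≤ 2 K^m + 1 ≤ 2 (m+K)^m + 1`.
[folklore] -/
theorem descartesPencil : Sig.stub_descartesPencil := by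
  intro K m d S _hS
  show (pencil d S).det.roots.toFinset.card ≤ 2 * (m + K) ^ m + 1
  have h3 : K ^ m ≤ (m + K) ^ m := Nat.pow_le_pow_left (by omega) m
  by_cases hP : (pencil d S).det = 0
  · rw [hP, Polynomial.roots_zero]
    simp
  · have h1 := Literature.Computability.AlgebraicComplexity.card_roots_toFinset_le_of_card_support hP
    have h2 := card_support_det_pencil_le d S
    omega

/-! ## §3 The assembly against the tree decl (as in Recon.lean) -/

theorem MatrixDescartes_of (h₁ : Sig.stub_descartesPencil) (h₂ : Sig.stub_coreLargeFormats) :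
    MatrixDescartes := by
  intro c q hq
  obtain ⟨K₀, hK₀⟩ := h₂ c q hq
  refine ⟨max K₀ (2 ^ (2 * q)), ?_⟩
  intro K m hK hm d S hS
  have hK₀K : K₀ ≤ K := le_trans (le_max_left _ _) hK
  have hKq : 2 ^ (2 * q) ≤ K := le_trans (le_max_right _ _) hK
  by_cases hreg : K < m * (Nat.log 2 (m + K) + 1)
  · exact hK₀ K m hK₀K hm hreg d S hS
  · have hreg' : m * (Nat.log 2 (m + K) + 1) ≤ K := not_lt.mp hreg
    have hZ1 := h₁ K m d S hS
    generalize (Matrix.det (∑ l, ((Polynomial.X : Polynomial ℝ) ^ d l) •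
      (S l).map Polynomial.C)).roots.toFinset.card = Z at hZ1 ⊢
    have hlt : m + K < 2 ^ (Nat.log 2 (m + K) + 1) := Nat.lt_pow_succ_log_self (by norm_num) _
    have hmK : (m + K) ^ m ≤ 2 ^ K := by
      calc (m + K) ^ m ≤ (2 ^ (Nat.log 2 (m + K) + 1)) ^ m := Nat.pow_le_pow_left hlt.le m
        _ = 2 ^ (m * (Nat.log 2 (m + K) + 1)) := by rw [← pow_mul, mul_comm]
        _ ≤ 2 ^ K := Nat.pow_le_pow_right (by norm_num) hreg'
    have hZ2 : Z ≤ 2 ^ (K + 2) := by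
      have e : 2 ^ (K + 2) = 2 ^ K * 4 := by rw [pow_add]; norm_num
      have ho : 1 ≤ 2 ^ K := Nat.one_le_two_pow
      omega
    have hL : 2 * q ≤ Nat.log 2 K := Nat.le_log_of_pow_le (by norm_num) hKq
    have hK2 : 2 ≤ K := by
      have : 2 ^ 1 ≤ 2 ^ (2 * q) := Nat.pow_le_pow_right (by norm_num) (by omega)
      omega
    calc Z ^ q ≤ (2 ^ (K + 2)) ^ q := Nat.pow_le_pow_left hZ2 q
      _ = 2 ^ ((K + 2) * q) := by rw [← pow_mul]
      _ ≤ 2 ^ (K * Nat.log 2 K) := by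
          apply Nat.pow_le_pow_right (by norm_num)
          nlinarith [Nat.mul_le_mul_left K hL, Nat.mul_le_mul_right q hK2]

/-! ## §4 The finding: the open stub is the crux -/

/-- `CoreLargeFormats` is a weakening of the crux by an extra hypothesis… -/
theorem coreLargeFormats_of_matrixDescartes (h : MatrixDescartes) : Sig.stub_coreLargeFormats := by
  intro c q hq
  obtain ⟨K₀, hK₀⟩ := h c q hq
  exact ⟨K₀, fun K m hK hm _ d S hS => hK₀ K m hK hm d S hS⟩

/-- … and, `DescartesPencil` being a theorem, it gives the crux back: the birth skeleton's only open
stub is EQUIVALENT to the crux `MatrixDescartes` (stmt-ValiantsHypothesis-18050). -/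
theorem matrixDescartes_iff_coreLargeFormats : MatrixDescartes ↔ Sig.stub_coreLargeFormats :=
  ⟨coreLargeFormats_of_matrixDescartes, MatrixDescartes_of descartesPencil⟩

end Summit.ValiantsHypothesis.ValiantsHypothesis.Cruxes.MatrixDescartes.Design
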